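import Literature.Probability.FitznerVanDerHofstad2017.NobleBoundsN1Class10
import HarnessLib

/-!
# Fitzner–van der Hofstad (2017), §6.1 — the class `(a,b) = (1,≥2)` of the bound (6.4) at `N = 1`, PROVED

[FvdH17] = R. Fitzner, R. van der Hofstad, *Mean-field behavior for nearest-neighbor percolation in `d > 10`*,
Electron. J. Probab. **22** (2017), no. 43; extended version arXiv:1506.07977v2, v2 p. 59 (TeX source l.9885–9888,
l.9893–9894 and l.9922–9927):

  "**Case `a = 1`.** We conclude from `a = 1` that `u` and `w` are neighbors, `2dD(u−w) = 1`, the bond `{u,w}` is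
  occupied and `u ≠ 0`. We split between `w = 0` and `w ≠ 0` to obtain the desired bound:
  `δ_{w,0} 𝓑_{1̲,3}(u,0) + 𝓣_{1,1̲,1}(u,w,0) = P^{S,1}(u,w)`."
  "**Cases `a ≥ 1` and `b ≥ 1`.** For `a ≥ 1` and `b ≥ 1`, the two paths realising the connections
  `{(u,u+e_ι) occ., u+e_ι ↔ t}` and `{w ↔ z}` have no common vertices, leading to a repulsive diagram. Thus, we
  obtain `𝓑_{1̲,0}(e_ι−u,t−u) τ_p(z−w) ≤ Ā^{ι,a,b}(u,w,z,t)`. When `a = 1` and/or `b = 1`, we include the information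
  that either `u,w` and/or `z,t` are neighbors into the definition of `Ā^{ι,a,b}`."

## What is proved

`jointWit_cls_1_2` — the instance `(a,b) = (1,2)` of the hypothesis `h2` of
`NobleBoundsN1Classes.nobleXiT_one_le_blocks_of_cls`:

  `J(v−u) · ℙ_p^{⊗2}(jointWit u v w z t x ∩ class (1,2)) ≤ Σ_ι 𝟙{v = u+e_ι} P^{S,1}(u,w) Ā'^{ι,1,2}(u,w,t,z) P^{E,2}(t−x,z−x)`.

On the class, `w ≠ u` with the bond `(u,w)` OPEN on level `0`, and `t ≠ z` with the bond `(t,z)` CLOSED on level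
`1` (so `t, z ≠ x` by the canonical clause and the level-`1` witness of `{t ↔ z}` has length `≥ 2`).  The level-`0`
witnesses are RE-ROUTED onto the open bond (`NobleRerouteClassOneBond.exists_reroute_openConn`, tail seat); a.s.
it is a lattice bond, `w − u = e_κ`, and for `w = 0` the witness of `{0 ↔ u}` avoiding `(0,u)` has length `≥ 3`
(parity).  Regrouping: LEFT as in the class `(1,0)` (`𝓑_{3,1̲}(u,0)` / `𝓣_{1,1̲,1}(u,w,0)`), MIDDLE =
`{u ←1̲→ u+e_ι}₀, {u+e_ι ↔ t}₁, {z ↔ w}₀` bounded by the product of marginals `p τ_0(t−v) τ_0(w−z)` = the typed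
App. B entry `(1/p) S*_{0,1̲,1̲,0}` of `Ā^{ι,1,2}` once `τ_{1̲}(u−w) = p` cancels the `1/p`
(`NobleBoundsN1ClassTools.piPerc_mid_one_two_le_blockAbar'`), RIGHT = `{x↔t}₁ ⊛ {t ←2→ z}₁ ⊛ {z↔x}₁ ≤
P^{E,2}(t−x,z−x)`.  No hypothesis beyond the displayed objects; no numeral; no dimension.
-/

namespace Literature.Probability.FitznerVanDerHofstad2017

open Literature.Barriers.CriticalPhenomena Literature.Probability.Percolation Literature.Probability.LatticeModels
open Literature.Probability.FitznerVanDerHofstad2017.NobleBlocks MeasureTheory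
open Literature.Probability.FitznerVanDerHofstad2017.NobleBlocks.LenIdx
open scoped ENNReal BigOperators

variable {d : ℕ}

/-- Bookkeeping for the class `(1,2)`, sub-case `w = 0`: LEFT `![{0←3→u}₀, {u←1̲→0}₀]` served by the re-routed
witness `L₁` of `{0↔u}` and the bond; MIDDLE `![{u←1̲→v}₀, {v↔t}₁, {z↔w}₀]` by `{b₀}, K₁ 0, L₄`; RIGHT
`![{x←1→t}₁, {t←2→z}₁, {z←1→x}₁]` by `K₁ 2, K₁ 1, K₁ 3`.  Pools: level `0` = `Sum.elim ![L₁, L₂, {(u,w)}, L₄] ![{b₀}]`,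
repulsive level `1` = `![K₁ 0]`, free level `1` = `![K₁ 1, K₁ 2, K₁ 3]`. [folklore] -/
def src12z : Fin 2 ⊕ (Fin 3 ⊕ Fin 3) → (Fin 4 ⊕ Fin 1) ⊕ (Fin 1 ⊕ Fin 3) :=
  Sum.elim ![Sum.inl (Sum.inl 0), Sum.inl (Sum.inl 2)]
    (Sum.elim ![Sum.inl (Sum.inr 0), Sum.inr (Sum.inl 0), Sum.inl (Sum.inl 3)]
      ![Sum.inr (Sum.inr 1), Sum.inr (Sum.inr 0), Sum.inr (Sum.inr 2)])

/-- Bookkeeping for the class `(1,2)`, sub-case `w ≠ 0`: LEFT `![{0←1→u}₀, {u←1̲→w}₀, {w←1→0}₀]` served by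
`L₁`, the bond, `L₂`; MIDDLE and RIGHT as in `src12z`. [folklore] -/
def src12n : Fin 3 ⊕ (Fin 3 ⊕ Fin 3) → (Fin 4 ⊕ Fin 1) ⊕ (Fin 1 ⊕ Fin 3) :=
  Sum.elim ![Sum.inl (Sum.inl 0), Sum.inl (Sum.inl 2), Sum.inl (Sum.inl 1)]
    (Sum.elim ![Sum.inl (Sum.inr 0), Sum.inr (Sum.inl 0), Sum.inl (Sum.inl 3)]
      ![Sum.inr (Sum.inr 1), Sum.inr (Sum.inr 0), Sum.inr (Sum.inr 2)])

/-- **[FvdH17] §6.1, Case `a = 1, b ≥ 2` of (6.4) at `N = 1`.**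
`J(v−u) ℙ_p^{⊗2}(jointWit u v w z t x ∩ class (1,2)) ≤ Σ_ι 𝟙{v = u+e_ι} P^{S,1}(u,w) Ā'^{ι,1,2}(u,w,t,z) P^{E,2}(t−x,z−x)`.
[cite: FitznerVanDerHofstad2017, §6.1 "Case a = 1" and "Cases a ≥ 1 and b ≥ 1" (arXiv:1506.07977v2 p. 59)] -/
theorem jointWit_cls_1_2 (p : unitInterval) (x u v w z t : Site d) :
    ENNReal.ofReal (bondJ d p (v - u)) * piPerc d p 2 (jointWit u v w z t x ∩ clsSet u w t z 1 2) ≤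
      ∑ ι : Fin d × Bool, (if v = u + stepVec ι then (1 : ℝ≥0∞) else 0) *
        (blockPS (Letters.perc d p) 1 u w * blockAbar' (Letters.perc d p) ι 1 2 u w t z *
          blockPE (Letters.perc d p) 2 (t - x) (z - x)) := by
  classical
  set F := jointWit u v w z t x ∩ clsSet u w t z 1 2 with hF
  -- the bond factor `J(v - u)`
  by_cases hadj : (zdGraph d).Adj 0 (v - u)
  swap
  · rw [ofReal_bondJ_eq_zero_of_not_adj p hadj, zero_mul]; exact zero_le
  obtain ⟨ι₀, hι₀⟩ := (zdGraph_adj_iff_stepVec 0 (v - u)).1 hadj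
  have hv : v = u + stepVec ι₀ := by rw [zero_add] at hι₀; exact sub_eq_iff_eq_add'.1 hι₀
  have huv : u ≠ v := by rintro rfl; rw [sub_self] at hadj; exact hadj.ne rfl
  have he : s(u, v) ∈ (zdGraph d).edgeSet :=
    (SimpleGraph.mem_edgeSet _).2 ((zdGraph_adj_iff_stepVec u v).2 ⟨ι₀, hv⟩)
  rw [bondJ_def, if_pos hadj]
  -- an empty class contributes nothing; otherwise read off the side conditions
  by_cases hne : F.Nonempty
  swap
  · rw [Set.not_nonempty_iff_eq_empty.1 hne, measure_empty, mul_zero]; exact zero_le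
  obtain ⟨ω₀, hjw₀, hcls₀⟩ := hne
  obtain ⟨⟨h0w, hzx', hwv, -, -, -, -⟩, -⟩ := (mem_jointWit_iff u v w z t x ω₀).1 hjw₀
  have huw : u ≠ w := ((mem_lineCls_one_iff u w 0 ω₀).1 hcls₀.1).1
  have htz : t ≠ z := ((mem_lineCls_two_iff t z 1 ω₀).1 hcls₀.2).1
  have hu0 : u ≠ 0 := fun h => huw (h.trans (h0w h).symm)
  have htx : t ≠ x := fun h => htz (h.trans (hzx'.2 h).symm)
  have hzx : z ≠ x := fun h => htz ((hzx'.1 h).trans h.symm)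
  -- the `ι`-sum is at least its `ι₀` term
  refine le_trans ?_ (term_le_sum_ite ι₀ hv _)
  -- absorb `p` as the open bond `b₀` on level `0`, and intersect with the a.s. event `ω₀ ⊆ E(ℤ^d)`
  have hFm : MeasurableSet F := (measurableSet_jointWit u v w z t x).inter (measurableSet_clsSet u w t z 1 2)
  have habs := ofReal_mul_piPerc_preimage_eraseAt0 p he hFm
  rw [hF, eraseAt0_preimage_jointWit_inter_clsSet, ← hF] at habs
  rw [habs]
  refine (piPerc_le_inter_lattice₀ p _).trans ?_
  set S := {ω : Fin 2 → BondConfig (Site d) | s(u, v) ∈ ω 0} ∩ F ∩ {ω | ω 0 ⊆ (zdGraph d).edgeSet} with hS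
  -- if `(u,w)` is not a lattice bond the event is empty
  by_cases hadjw : (zdGraph d).Adj u w
  swap
  · have hS0 : S = ∅ := Set.eq_empty_iff_forall_notMem.2 fun ω hω => hadjw <| by
      obtain ⟨⟨-, -, hcls⟩, hE⟩ := hω
      exact (SimpleGraph.mem_edgeSet _).1 (hE ((mem_lineCls_one_iff u w 0 ω).1 hcls.1).2)
    rw [hS0, measure_empty]; exact zero_le
  obtain ⟨κ, hκ⟩ := (zdGraph_adj_iff_stepVec u w).1 hadjw
  -- the middle and right line families (common to both sub-cases)
  set AM : Fin 3 → Set (BondConfig (Site d)) := ![event (eq 1) u v, event (ge 0) v t, event (ge 0) z w] with hAM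
  set AE : Fin 3 → Set (BondConfig (Site d)) := ![event (ge 1) x t, event (ge 2) t z, event (ge 1) z x] with hAE
  set cM : Fin 3 → Fin 2 := ![0, 1, 0] with hcM
  set cE : Fin 3 → Fin 2 := ![1, 1, 1] with hcE
  have hfM : ∀ i, IsFinitary (AM i) := fun i => by
    rw [hAM]; fin_cases i
    exacts [isFinitary_event (eq 1) u v, isFinitary_event (ge 0) v t, isFinitary_event (ge 0) z w]
  have hfE : ∀ i, IsFinitary (AE i) := fun i => by
    rw [hAE]; fin_cases i
    exacts [isFinitary_event (ge 1) x t, isFinitary_event (ge 2) t z, isFinitary_event (ge 1) z x]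
  have hM : piPerc d p 2 (genDisjOcc AM cM) ≤ blockAbar' (Letters.perc d p) ι₀ 1 2 u w t z :=
    piPerc_mid_one_two_le_blockAbar' p hv hκ cM
  have hE : piPerc d p 2 (genDisjOcc AE cE) ≤ blockPE (Letters.perc d p) 2 (t - x) (z - x) :=
    piPerc_end_two_le_blockPE p htx hzx cE
  -- the RE-ROUTED witnesses of a point of `S`, with the facts both sub-cases use
  have hwit : ∀ ω ∈ S, ∃ (N₀ : Fin 4 → Set (Sym2 (Site d))) (K₁ : Fin 4 → Set (Sym2 (Site d))),
      (∀ j, N₀ j ⊆ ω 0) ∧ (∀ j, K₁ j ⊆ ω 1) ∧ ω 0 ⊆ (zdGraph d).edgeSet ∧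
      (Pairwise fun a a' => Disjoint (Sum.elim N₀ ![({s(u, v)} : Set (Sym2 (Site d)))] a)
        (Sum.elim N₀ ![{s(u, v)}] a')) ∧
      (Pairwise fun i j => Disjoint (K₁ i) (K₁ j)) ∧ (∀ j, Disjoint (N₀ j) (K₁ 0)) ∧
      Disjoint ({s(u, v)} : Set (Sym2 (Site d))) (K₁ 0) ∧ s(u, v) ∈ ω 0 ∧
      N₀ 0 ∈ (openConn 0 u : Set (BondConfig (Site d))) ∧ N₀ 1 ∈ (openConn 0 w : Set (BondConfig (Site d))) ∧
      N₀ 2 = {s(w, u)} ∧ N₀ 3 ∈ (openConn z w : Set (BondConfig (Site d))) ∧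
      s(w, u) ∉ N₀ 0 ∧ s(w, u) ∉ N₀ 1 ∧
      K₁ 0 ∈ (openConn v t : Set (BondConfig (Site d))) ∧ K₁ 1 ∈ (openConnGe 2 t z : Set (BondConfig (Site d))) ∧
      K₁ 2 ∈ (openConn x t : Set (BondConfig (Site d))) ∧ K₁ 3 ∈ (openConn z x : Set (BondConfig (Site d))) := by
    rintro ω ⟨⟨hb0, hjw, hcls⟩, hωE⟩
    obtain ⟨-, K₀, K₁, h₀, h₁, hA₀, hA₁, hd₀, hd₁, hc₀, -, -⟩ := (mem_jointWit_iff u v w z t x ω).1 hjw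
    have hopen : s(u, w) ∈ ω 0 := ((mem_lineCls_one_iff u w 0 ω).1 hcls.1).2
    have hclosed : s(t, z) ∉ ω 1 := ((mem_lineCls_two_iff t z 1 ω).1 hcls.2).2
    have hK₀ω : ∀ j, K₀ j ⊆ ω 0 := fun j => (h₀ j).trans (offBonds_subset _ _)
    have hK₁ω : ∀ j, K₁ j ⊆ ω 1 := fun j => (h₁ j).trans (offBonds_subset _ _)
    have hb₀K₀ : ∀ j, s(u, v) ∉ K₀ j := fun j h => by
      have h' := h₀ j h; rw [offBonds_def] at h'; exact h'.2 rfl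
    have huK₁ : ∀ e ∈ K₁ 0, u ∉ e := fun e he hu => by
      have h' := h₁ 0 he; rw [offBonds_def] at h'
      exact h'.2 ((mem_bondsAt_singleton_iff u _).2 hu)
    have hK03 : K₀ 3 ∈ (openConn w z : Set (BondConfig (Site d))) := hA₀ 3
    have hK11 : K₁ 1 ∈ (openConn t z : Set (BondConfig (Site d))) := hA₁ 1
    have hK12 : K₁ 2 ∈ (openConn t x : Set (BondConfig (Site d))) := hA₁ 2
    -- re-route the level-0 witnesses onto the open bond `(u,w)`
    obtain ⟨L₁, L₂, L₄, hL₁s, hL₂s, hL₄s, -, hL₁, hL₂, hL₄, hn₁, hn₂, hn₄, dL₁₂, dL₁₄, dL₂₄⟩ :=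
      exists_reroute_openConn (hA₀ 0 : K₀ 0 ∈ (openConn 0 u : Set (BondConfig (Site d))))
        (hA₀ 1 : K₀ 1 ∈ (openConn 0 w : Set (BondConfig (Site d))))
        (hA₀ 2 : K₀ 2 ∈ (openConn w u : Set (BondConfig (Site d)))) hK03
        (hd₀ (by decide)) (hd₀ (by decide)) (hd₀ (by decide)) (hd₀ (by decide)) (hd₀ (by decide))
        (hd₀ (by decide))
    have hU₃ : K₀ 0 ∪ K₀ 1 ∪ K₀ 2 ⊆ ω 0 := Set.union_subset (Set.union_subset (hK₀ω 0) (hK₀ω 1)) (hK₀ω 2)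
    have hU₂ : K₀ 3 ∪ K₀ 2 ⊆ ω 0 := Set.union_subset (hK₀ω 3) (hK₀ω 2)
    have hb₀U₃ : s(u, v) ∉ K₀ 0 ∪ K₀ 1 ∪ K₀ 2 := by
      rintro ((h | h) | h)
      exacts [hb₀K₀ 0 h, hb₀K₀ 1 h, hb₀K₀ 2 h]
    have hb₀U₂ : s(u, v) ∉ K₀ 3 ∪ K₀ 2 := by
      rintro (h | h)
      exacts [hb₀K₀ 3 h, hb₀K₀ 2 h]
    have hK₁U₃ : Disjoint (K₀ 0 ∪ K₀ 1 ∪ K₀ 2) (K₁ 0) :=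
      Disjoint.union_left (Disjoint.union_left (hc₀ 0).symm (hc₀ 1).symm) (hc₀ 2).symm
    have hK₁U₂ : Disjoint (K₀ 3 ∪ K₀ 2) (K₁ 0) := Disjoint.union_left (hc₀ 3).symm (hc₀ 2).symm
    have hwu_b₀ : s(w, u) ≠ s(u, v) := fun h => by
      rcases Sym2.eq_iff.1 h with ⟨h1, -⟩ | ⟨h1, -⟩
      · exact huw h1.symm
      · exact hwv h1
    set N₀ : Fin 4 → Set (Sym2 (Site d)) := ![L₁, L₂, {s(w, u)}, L₄] with hN₀
    have hN₀d : Pairwise fun i j => Disjoint (N₀ i) (N₀ j) :=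
      pairwise_disjoint_vec4 dL₁₂ (Set.disjoint_singleton_right.2 hn₁) dL₁₄ (Set.disjoint_singleton_right.2 hn₂)
        dL₂₄ (Set.disjoint_singleton_left.2 hn₄)
    have hN₀b : ∀ j, Disjoint (N₀ j) {s(u, v)} := by
      intro j; fin_cases j
      · exact Set.disjoint_singleton_right.2 fun h => hb₀U₃ (hL₁s h)
      · exact Set.disjoint_singleton_right.2 fun h => hb₀U₃ (hL₂s h)
      · exact Set.disjoint_singleton.2 hwu_b₀
      · exact Set.disjoint_singleton_right.2 fun h => hb₀U₂ (hL₄s h)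
    refine ⟨N₀, K₁, ?_, hK₁ω, hωE, pairwise_disjoint_pool₀ hN₀d hN₀b, hd₁, ?_,
      Set.disjoint_singleton_left.2 fun h => huK₁ _ h (Sym2.mem_mk_left u v), hb0, hL₁, hL₂, rfl,
      SimpleGraph.Reachable.symm hL₄, hn₁, hn₂, hA₁ 0,
      mem_openConnGe_two_of_notMem hK11 htz fun h => hclosed (hK₁ω 1 h), SimpleGraph.Reachable.symm hK12, hA₁ 3⟩
    · intro j; fin_cases j
      · exact hL₁s.trans hU₃
      · exact hL₂s.trans hU₃
      · exact Set.singleton_subset_iff.2 (by rw [Sym2.eq_swap]; exact hopen)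
      · exact hL₄s.trans hU₂
    · intro j; fin_cases j
      · exact hK₁U₃.mono_left hL₁s
      · exact hK₁U₃.mono_left hL₂s
      · exact Set.disjoint_singleton_left.2 fun h => huK₁ _ h (Sym2.mem_mk_right w u)
      · exact hK₁U₂.mono_left hL₄s
  -- the two sub-cases `w = 0` / `w ≠ 0` of the left triangle
  rcases eq_or_ne w 0 with hw0 | hw0
  · -- `w = 0`: LEFT = `{0 ←3→ u}₀ ⊛ {u ←1̲→ 0}₀ ≤ 𝓑_{3,1̲}(u,0)` (parity)
    set AS : Fin 2 → Set (BondConfig (Site d)) := ![event (ge 3) 0 u, event (eq 1) u 0] with hAS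
    set cS : Fin 2 → Fin 2 := ![0, 0] with hcS
    have hfS : ∀ i, IsFinitary (AS i) := fun i => by
      rw [hAS]; fin_cases i; exacts [isFinitary_event (ge 3) 0 u, isFinitary_event (eq 1) u 0]
    have hS' : piPerc d p 2 (genDisjOcc AS cS) ≤ blockPS (Letters.perc d p) 1 u w := by
      rw [hw0]; exact piPerc_start_one_zero_le_blockPS p hu0 cS
    have h0u : (zdGraph d).Adj 0 u := by rw [hw0] at hadjw; exact hadjw.symm
    have hincl : S ⊆ genDisjOccGrouped (Sum.elim AS (Sum.elim AM AE)) (Sum.elim cS (Sum.elim cM cE)) tag3 := by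
      intro ω hω
      obtain ⟨N₀, K₁, hN₀ω, hK₁ω, hωE, hPd, hd₁, hc₀, hb₀K₁, hb0, hN0, -, hN2, hN3, hn0, -, hK10, hK11, hK12,
        hK13⟩ := hwit ω hω
      refine mem_genDisjOccGrouped_of_pools₃ _ _ _ ω (Sum.elim N₀ ![({s(u, v)} : Set (Sym2 (Site d)))])
        ![K₁ 0] ![K₁ 1, K₁ 2, K₁ 3] ?_ ?_ ?_ hPd ?_ ?_ src12z (by decide) (by decide) ?_ (by decide)
      · rintro (a | a)
        · exact hN₀ω a
        · fin_cases a; exact Set.singleton_subset_iff.2 hb0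
      · intro b; fin_cases b; exact hK₁ω 0
      · intro r; fin_cases r
        · exact hK₁ω 1
        · exact hK₁ω 2
        · exact hK₁ω 3
      · rintro (b | b) (b' | b') hbb' <;> fin_cases b <;> fin_cases b' <;> simp at hbb' ⊢ <;> exact hd₁ (by decide)
      · rintro (a | a) b <;> fin_cases b
        · exact hc₀ a
        · fin_cases a; exact hb₀K₁
      · rintro (i | i | i) <;> fin_cases i
        · show N₀ 0 ∈ (event (ge 3) 0 u : Set (BondConfig (Site d)))
          rw [event_ge]
          refine mem_openConnGe_three_of_notMem ((hN₀ω 0).trans hωE) h0u hN0 ?_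
          rw [← hw0]; exact hn0
        · show N₀ 2 ∈ (event (eq 1) u 0 : Set (BondConfig (Site d)))
          rw [event_eq, hN2, ← hw0]
          exact mem_openConnEq_one_of_mem huw (by rw [Sym2.eq_swap]; exact Set.mem_singleton _)
        · show ({s(u, v)} : Set (Sym2 (Site d))) ∈ (event (eq 1) u v : Set (BondConfig (Site d)))
          rw [event_eq]; exact mem_openConnEq_one_of_mem huv (Set.mem_singleton _)
        · show K₁ 0 ∈ (event (ge 0) v t : Set (BondConfig (Site d)))
          rw [event_ge, openConnGe_zero]; exact hK10
        · show N₀ 3 ∈ (event (ge 0) z w : Set (BondConfig (Site d)))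
          rw [event_ge, openConnGe_zero]; exact hN3
        · show K₁ 2 ∈ (event (ge 1) x t : Set (BondConfig (Site d)))
          rw [event_ge, openConnGe_one_eq htx.symm]; exact hK12
        · show K₁ 1 ∈ (event (ge 2) t z : Set (BondConfig (Site d)))
          rw [event_ge]; exact hK11
        · show K₁ 3 ∈ (event (ge 1) z x : Set (BondConfig (Site d)))
          rw [event_ge, openConnGe_one_eq hzx]; exact hK13
    calc piPerc d p 2 S
        ≤ piPerc d p 2 (genDisjOccGrouped (Sum.elim AS (Sum.elim AM AE)) (Sum.elim cS (Sum.elim cM cE)) tag3) :=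
          measure_mono hincl
      _ ≤ piPerc d p 2 (genDisjOcc AS cS) * piPerc d p 2 (genDisjOcc AM cM) * piPerc d p 2 (genDisjOcc AE cE) :=
          piPerc_genDisjOccGrouped_tag3_le p AS AM AE cS cM cE hfS hfM hfE
      _ ≤ _ := mul_le_mul' (mul_le_mul' hS' hM) hE
  · -- `w ≠ 0`: LEFT = `{0 ←1→ u}₀ ⊛ {u ←1̲→ w}₀ ⊛ {w ←1→ 0}₀ ≤ 𝓣_{1,1̲,1}(u,w,0)`
    set AS : Fin 3 → Set (BondConfig (Site d)) := ![event (ge 1) 0 u, event (eq 1) u w, event (ge 1) w 0] with hAS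
    set cS : Fin 3 → Fin 2 := ![0, 0, 0] with hcS
    have hfS : ∀ i, IsFinitary (AS i) := fun i => by
      rw [hAS]; fin_cases i
      exacts [isFinitary_event (ge 1) 0 u, isFinitary_event (eq 1) u w, isFinitary_event (ge 1) w 0]
    have hS' : piPerc d p 2 (genDisjOcc AS cS) ≤ blockPS (Letters.perc d p) 1 u w :=
      piPerc_start_one_ne_le_blockPS p hu0 hw0 cS
    have hincl : S ⊆ genDisjOccGrouped (Sum.elim AS (Sum.elim AM AE)) (Sum.elim cS (Sum.elim cM cE)) tag3 := by
      intro ω hω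
      obtain ⟨N₀, K₁, hN₀ω, hK₁ω, -, hPd, hd₁, hc₀, hb₀K₁, hb0, hN0, hN1, hN2, hN3, -, -, hK10, hK11, hK12,
        hK13⟩ := hwit ω hω
      refine mem_genDisjOccGrouped_of_pools₃ _ _ _ ω (Sum.elim N₀ ![({s(u, v)} : Set (Sym2 (Site d)))])
        ![K₁ 0] ![K₁ 1, K₁ 2, K₁ 3] ?_ ?_ ?_ hPd ?_ ?_ src12n (by decide) (by decide) ?_ (by decide)
      · rintro (a | a)
        · exact hN₀ω a
        · fin_cases a; exact Set.singleton_subset_iff.2 hb0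
      · intro b; fin_cases b; exact hK₁ω 0
      · intro r; fin_cases r
        · exact hK₁ω 1
        · exact hK₁ω 2
        · exact hK₁ω 3
      · rintro (b | b) (b' | b') hbb' <;> fin_cases b <;> fin_cases b' <;> simp at hbb' ⊢ <;> exact hd₁ (by decide)
      · rintro (a | a) b <;> fin_cases b
        · exact hc₀ a
        · fin_cases a; exact hb₀K₁
      · rintro (i | i | i) <;> fin_cases i
        · show N₀ 0 ∈ (event (ge 1) 0 u : Set (BondConfig (Site d)))
          rw [event_ge, openConnGe_one_eq hu0.symm]; exact hN0
        · show N₀ 2 ∈ (event (eq 1) u w : Set (BondConfig (Site d)))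
          rw [event_eq, hN2]
          exact mem_openConnEq_one_of_mem huw (by rw [Sym2.eq_swap]; exact Set.mem_singleton _)
        · show N₀ 1 ∈ (event (ge 1) w 0 : Set (BondConfig (Site d)))
          rw [event_ge, openConnGe_one_eq hw0]; exact SimpleGraph.Reachable.symm hN1
        · show ({s(u, v)} : Set (Sym2 (Site d))) ∈ (event (eq 1) u v : Set (BondConfig (Site d)))
          rw [event_eq]; exact mem_openConnEq_one_of_mem huv (Set.mem_singleton _)
        · show K₁ 0 ∈ (event (ge 0) v t : Set (BondConfig (Site d)))
          rw [event_ge, openConnGe_zero]; exact hK10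
        · show N₀ 3 ∈ (event (ge 0) z w : Set (BondConfig (Site d)))
          rw [event_ge, openConnGe_zero]; exact hN3
        · show K₁ 2 ∈ (event (ge 1) x t : Set (BondConfig (Site d)))
          rw [event_ge, openConnGe_one_eq htx.symm]; exact hK12
        · show K₁ 1 ∈ (event (ge 2) t z : Set (BondConfig (Site d)))
          rw [event_ge]; exact hK11
        · show K₁ 3 ∈ (event (ge 1) z x : Set (BondConfig (Site d)))
          rw [event_ge, openConnGe_one_eq hzx]; exact hK13
    calc piPerc d p 2 S
        ≤ piPerc d p 2 (genDisjOccGrouped (Sum.elim AS (Sum.elim AM AE)) (Sum.elim cS (Sum.elim cM cE)) tag3) :=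
          measure_mono hincl
      _ ≤ piPerc d p 2 (genDisjOcc AS cS) * piPerc d p 2 (genDisjOcc AM cM) * piPerc d p 2 (genDisjOcc AE cE) :=
          piPerc_genDisjOccGrouped_tag3_le p AS AM AE cS cM cE hfS hfM hfE
      _ ≤ _ := mul_le_mul' (mul_le_mul' hS' hM) hE

end Literature.Probability.FitznerVanDerHofstad2017
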